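import Mathlib.Topology.Order.Basic
import Mathlib.Topology.ContinuousOn
import Mathlib.Order.ConditionallyCompleteLattice.Basic
import Mathlib.Topology.Instances.Real.Lemmas

/-!
# The continuity (bootstrap) principle on a half-open time interval

Helper file for the line `log-lipschitz-budget` of the crux `ImplosionDichotomy.PolynomialCompression`
(stmt-AtomisticToContinuum-12587), stub `stub_logBudgetShadowing` (§5 "closing" of the blueprint
`Cruxes/PolynomialCompression/Lines/log-lipschitz-budget-stub4.md`): the abstract real-analysis shell of
a bootstrap argument. Finitely many continuous quantities `g i : ℝ → ℝ` (sup norms and energies of the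
difference of two classical solutions) are compared with continuous positive thresholds `b i`; if the
WEAK bounds `g i s ≤ 2 b i s` on an initial segment `[0, t]` always IMPROVE to the strong bounds
`g i t ≤ b i t` (this is where the energy estimates enter), and the strong bounds hold at `t = 0`, then
the strong bounds hold on all of `[0, T)`.
-/

namespace Summit.AtomisticToContinuum.HydrodynamicLimit.Theorems

open Set

/-- **Bootstrap / continuity principle.** Let `g i, b i` (`i` in a finite index type) be continuous
on `[0, T)` with `b i > 0` there and `g i 0 ≤ b i 0`. If for every `t ∈ [0, T)` the weak bounds
`g i s ≤ 2 * b i s` for all `i` and all `s ∈ [0, t]` imply the strong bounds `g i t ≤ b i t` for all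
`i`, then `g i t ≤ b i t` for all `i` and all `t ∈ [0, T)`. [folklore] -/
theorem bootstrap_of_continuousOn :
    ∀ {ι : Type} [Finite ι] {T : ℝ} {g b : ι → ℝ → ℝ}, (∀ i, ContinuousOn (g i) (Ico 0 T)) →
      (∀ i, ContinuousOn (b i) (Ico 0 T)) → (∀ i, ∀ t ∈ Ico 0 T, 0 < b i t) → (∀ i, g i 0 ≤ b i 0) →
      (∀ t ∈ Ico 0 T, (∀ i, ∀ s ∈ Icc 0 t, g i s ≤ 2 * b i s) → ∀ i, g i t ≤ b i t) →
      ∀ i, ∀ t ∈ Ico 0 T, g i t ≤ b i t := by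
  intro ι _ T g b hg hb hbpos h0 himp
  classical
  -- it suffices to prove the WEAK bounds everywhere (then `himp` upgrades them)
  suffices hweak : ∀ t ∈ Ico 0 T, ∀ i, ∀ s ∈ Icc 0 t, g i s ≤ 2 * b i s by
    intro i t ht
    exact himp t ht (hweak t ht) i
  intro t ht
  by_contra hcon
  push Not at hcon
  -- the set of "bad" times in `[0, t]`
  set S : Set ℝ := {s | s ∈ Icc 0 t ∧ ∃ i, 2 * b i s < g i s} with hS
  obtain ⟨i₀, s₀, hs₀, hlt₀⟩ := hcon
  have hSne : S.Nonempty := ⟨s₀, hs₀, i₀, hlt₀⟩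
  have hSbdd : BddBelow S := ⟨0, fun s hs => hs.1.1⟩
  set τ : ℝ := sInf S with hτ
  have hτmem_Icc : τ ∈ Icc 0 t :=
    ⟨le_csInf hSne fun s hs => hs.1.1, (csInf_le hSbdd ⟨hs₀, i₀, hlt₀⟩).trans hs₀.2⟩
  have hτT : τ ∈ Ico 0 T := ⟨hτmem_Icc.1, hτmem_Icc.2.trans_lt ht.2⟩
  -- strictly before `τ` the weak bounds hold
  have hbefore : ∀ s ∈ Ico 0 τ, ∀ i, g i s ≤ 2 * b i s := by
    intro s hs i
    by_contra hlt
    push Not at hlt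
    have hsS : s ∈ S := ⟨⟨hs.1, (hs.2.le.trans hτmem_Icc.2)⟩, i, hlt⟩
    exact absurd (csInf_le hSbdd hsS) (not_le.2 hs.2)
  -- by continuity the weak bounds hold AT `τ` as well, hence on `[0, τ]`
  have hat : ∀ i, g i τ ≤ 2 * b i τ := by
    intro i
    rcases eq_or_lt_of_le hτmem_Icc.1 with hτ0 | hτ0
    · -- `τ = 0`: the strong bound at `0`
      rw [← hτ0]
      have := h0 i
      have hb0 := hbpos i 0 ⟨le_rfl, ht.1.trans_lt ht.2⟩
      linarith
    · -- `τ > 0`: limit from the left along `[0, τ)`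
      have hcont : ContinuousWithinAt (fun s => 2 * b i s - g i s) (Ico 0 T) τ :=
        ((continuousWithinAt_const.mul (hb i τ hτT)).sub (hg i τ hτT))
      have hcont' : ContinuousWithinAt (fun s => 2 * b i s - g i s) (Ico 0 τ) τ :=
        hcont.mono (Ico_subset_Ico_right hτT.2.le)
      have hmem : τ ∈ closure (Ico 0 τ) := by
        rw [closure_Ico hτ0.ne]; exact ⟨hτ0.le, le_rfl⟩
      have hge : 0 ≤ 2 * b i τ - g i τ :=
        ContinuousWithinAt.closure_le (f := fun _ => (0 : ℝ)) (g := fun s => 2 * b i s - g i s)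
          hmem continuousWithinAt_const hcont' fun s hs => by
            have := hbefore s hs i; linarith
      linarith
  have hupto : ∀ i, ∀ s ∈ Icc 0 τ, g i s ≤ 2 * b i s := by
    intro i s hs
    rcases eq_or_lt_of_le hs.2 with h | h
    · rw [h]; exact hat i
    · exact hbefore s ⟨hs.1, h⟩ i
  -- so the STRONG bounds hold at `τ`, and by continuity the weak bounds hold a little beyond `τ`
  have hstrong : ∀ i, g i τ ≤ b i τ := himp τ hτT hupto
  have hnhds : ∀ i, ∀ᶠ s in nhdsWithin τ (Ico 0 T), g i s < 2 * b i s := by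
    intro i
    have hcont : ContinuousWithinAt (fun s => 2 * b i s - g i s) (Ico 0 T) τ :=
      ((continuousWithinAt_const.mul (hb i τ hτT)).sub (hg i τ hτT))
    have hpos : 0 < 2 * b i τ - g i τ := by
      have := hbpos i τ hτT; have := hstrong i; linarith
    have := hcont.eventually (eventually_gt_nhds hpos)
    exact this.mono fun s hs => by linarith
  have hall : ∀ᶠ s in nhdsWithin τ (Ico 0 T), ∀ i, g i s < 2 * b i s :=
    Filter.eventually_all.2 hnhds
  -- extract a uniform `δ > 0`
  rw [eventually_nhdsWithin_iff, Metric.eventually_nhds_iff] at hall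
  obtain ⟨δ, hδ, hδall⟩ := hall
  -- every `s ∈ S` satisfies `s ≥ τ` and is bad, so `s ≥ τ + δ` … but `τ = inf S`: contradiction
  have hSge : ∀ s ∈ S, τ + δ / 2 ≤ s := by
    intro s hs
    by_contra hlt
    push Not at hlt
    have hτs : τ ≤ s := csInf_le hSbdd hs
    have hsT : s ∈ Ico 0 T := ⟨hs.1.1, hs.1.2.trans_lt ht.2⟩
    have hdist : dist s τ < δ := by
      rw [Real.dist_eq, abs_of_nonneg (by linarith)]; linarith
    obtain ⟨i, hi⟩ := hs.2
    have := hδall hdist hsT i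
    linarith
  have : τ + δ / 2 ≤ τ := le_csInf hSne hSge
  linarith

end Summit.AtomisticToContinuum.HydrodynamicLimit.Theorems
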